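import Summits.ResolutionOfSingularities.ResolutionOfSingularities.Theorems.IsoCompanionCutKernels
import HarnessLib

/-!
# IsoCompanionCutCells — decomp-res node «IsoCompanionCut» (lens-4 g36, critic row 203 CLEARED (NP-C′) DECIDED +1 ·
MAP 0), tree file 2/2 of the node

Content VERBATIM from the decomp-res lens-4 g36 node `HOME/decomp-res-lens-4/g36/IsoCompanionCut.lean` (pin
38bd0157, 565 l; HOME = run/shared/lean/pub/decomp-res): NO carry — the node imports the LANDED tree only (g35
«CurveCut» = `Theorems/CurveCutKernels` · `CurveCutCells` · `CurveCutCornerGame`, landed 2026-08-31 by writer g13;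
`Theorems/WeightedInvariantOrderSemicontinuousSmooth`; Literature `QuasiExcellentSchemes` /
`ExcellentRingsFieldProofs` / `StalkIdealLemmas`); every declaration is new, same namespace
`…Theorems.HugValuationCut` (no collision with the landed files of that namespace — checked by name at staging).
Farm (node; lens + critic runs): rc 0 · 0 err · 0 warn · 0 sorry; `--axioms` std on `towerOfCompanion`,
`companionTower`, `companionTower_isDatum`, `companionTower_boundary`, `noTower_principalThreefold_of_port`,
`noTower_threefold_isolatedCompanion_of_port`, `recurrent_nonIsolation`,
`wildOccultDivisorialThreefoldNonLineMixed_split`,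
`noWildOccultDivisorialThreefoldNonLineIsolatedCompanionMixedTowers_holds_of_port`,
`noWildOccultNonLineMixedTowers_iff_g36_of_port`, `idealOrder_companionMarked_pt`; Probe rc 0 (24 must-fail sorries
= the 24 batteries); desk kit job j343472 (desk/DESK-g36.md: no root-letters candidate — finite death ≠ emptiness).
Critic: CRITIC-LEDGER row 203 «IsoCompanionCut» CLEARED — (NP-C′) DECIDED +1 ONCE (DECIDED-MOD-PORT(CJS 6.40) = the
rd-3 column's own currency, as at row 186) · MAP 0; window row 199 (NP-C′) + letter row 201a (c1)–(c5), desk-checked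
condition by condition: THE LETTER (I∞) `IsolatedCompanionTower` («some PRINCIPAL factor `h` of weight `a ≥ 2` of
the marked stalk `𝓘 = (h)·K` has its marked point ISOLATED in its own weight-`a` locus `Top(h_j, a)` at every later
stage»), THE TOOL `towerOfCompanion` / `companionTower` (the companion marked chain IS a forced tower: re-rooting at
stage `m`, persistence `idealOrder_companionMarked_pt` from g32 forcing, restriction to the semicontinuity-open `U₀
= {ord H ≤ a}` by g34 `towerRestrict`, datum / principal-root / threefold transport, synthetic empty boundary), and
THE WHOLE-SUB-KIND KILL `noTower_threefold_isolatedCompanion_of_port` — every `p`, every field, every class `P`,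
every weight: NO forced threefold tower has an isolated principal companion, MODULO THE SURFACE PORT
`SurfaceChainPort` (CJS2020 Thm 6.40), by consuming the CLOSED PRINCIPAL RING-DIMENSION-3 COLUMN BY NAME
(`noTower_principalThreefold_of_port` = `noTower_surfaceColumn_of_port h640` + `noTower_threefold_not_planeCone`,
same port only); the cut of the located residual cell C₃♮ EXACTLY into C₃♮ⁱ (∧ (I∞): DECIDED — EMPTY modulo the
port) and C₃♮ʳ (∧ ¬(I∞): UNDECIDED · IDEA-NEEDED — the recurrently non-isolated companion, the ruled / kangaroo
core; typed reading `recurrent_nonIsolation` proved from the letters), with the exact re-locations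
`…_iff_g36_of_port` down to THE LOCATED RESIDUAL after g36 `NoWildOccultRecurrentCompanionNonLineMixedTowers` (=
(C₃♮ʳ ∧ C₄) ∧ D₄; exactness mod `SurfaceChainPort` upward, hypothesis-free downward).  Landing orders = critic rider
INBOX :1298 (2026-08-31T09:35:11Z) + lens landing notes :1294 / :1296 = the NODE landing form (the two `══ FILE`
markers): FILE A `IsoCompanionCutKernels` = §115–§116 (cone-free; the node's imports — `CurveCutCells` ⊇ the rider's
`RestrictCutCells`), FILE B `IsoCompanionCutCells` = §117 (cone-free; imports FILE A; the cells BY NAME as in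
g33–g35, cn26); both VERBATIM, `--kind proof --supports stmt-ResolutionOfSingularities-28338`; no Theses-cone file
(lens correction :1296: NO declaration consumes h71 / 31571 — the :523 / :530 re-locations take only `(h640 :
SurfaceChainPort)`).  ASIDE 28338 bookkeeping (rider: «NO aside switch — the g35 ⟺ g36 exactness is MOD PORT; the
live lens-4 aside stays as filed (rev 60/61); 0-weight docstring patch»): the live lens-4 aside is item 26902
`RCNoWildOccultDivisorialOrNonThreefoldMixedTowers` (g34 located residual, home `RestrictCutCells`); the g35
residual `NoWildOccultNonLineMixedTowers` (home `CurveCutCells`) refines it hypothesis-free and the g36 residual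
(home THIS node's FILE B) refines that modulo the port
(`noWildOccultDivisorialOrNonThreefoldMixedTowers_iff_g36_of_port`; for the tree aside:
`noWildOccultRecurrentCompanionNonLineMixedTowers_of_aside`).  The `def … : Prop` declarations
(`IsolatedCompanionTower`, `WildOccultDivisorialThreefoldNonLineIsolatedCompanionMixedWallFreeFreshJumpShallowCompanionKangarooTowersTerminate`,
`WildOccultDivisorialThreefoldNonLineRecurrentCompanionMixedWallFreeFreshJumpShallowCompanionKangarooTowersTerminate`,
`NoWildOccultDivisorialThreefoldNonLineIsolatedCompanionMixedTowers`,
`NoWildOccultDivisorialThreefoldNonLineRecurrentCompanionMixedTowers`,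
`NoWildOccultRecurrentCompanionNonLineMixedTowers`) are THIS node's letter / cells (cn26) — none is a vendored fact;
`towerOfCompanion` / `companionTower` / `companionMarked` / `companionRootOpens` are data-valued definitions (a
`ForcedTower` term, a marked chain, an `Opens`).

The lens header, verbatim (carried in this file of the node):

> # IsoCompanionCut — decomp-res-lens-4 g36 node «IsoCompanionCut» (lane (NP-C′) of CRITIC row 199 / letter row 201a: THE
> RE-ROOTED COMPANION TOWER; «companion» here = the PRINCIPAL FACTOR `h` of the two-factor datum `𝓘 = (h)·K` of the occult
> letters (FactorCut g32), NOT the weight-`p^e` Hasse companion of the lens-4 g26 node «CompanionCut» — hence the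
distinct slug — the letter (I∞) `IsolatedCompanionTower` «some PRINCIPAL factor `h` of weight `a ≥ 2` of the marked
> stalk `𝓘_{x_m} = (h)·K_{x_m}` has its marked point ISOLATED in its OWN weight-`a` locus `Top(h_j, a)` at EVERY later stage
> `j`», the TOOL `towerOfCompanion` «the chain `(X_{m+j}, (h_j, E_j^{syn}, a), x_{m+j}, π_{m+j})` IS a forced tower» (a complete
> `ForcedTower` term: stages, blow-ups, centres and marked points those of `T` from stage `m`, marked ideals the BGMW chain of
> `(H, ∅, a)` — SYNTHETIC EMPTY BOUNDARY, no `ForcedTower` field consults the boundary except `transform_eq`, which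
holds by `rfl`),
> and the WHOLE-SUB-KIND KILL `noTower_threefold_isolatedCompanion_of_port` — every `p`, every field, EVERY class
`P`, every weight
> `n`: NO forced threefold tower has an isolated principal companion, MODULO THE SURFACE PORT `SurfaceChainPort` (= CJS2020
> Thm 6.40, `surfaceChainPort_iff_CJS2020`) — by CONSUMING THE CLOSED PRINCIPAL RING-DIMENSION-3 COLUMN BY NAME on
the re-rooted,
> RESTRICTED companion tower: the column's two all-characteristic constituents `noTower_surfaceColumn_of_port h640` (SurfacePort
> §89, the PlaneCone branch, port-bound) and `TauChainLaw2.noTower_threefold_not_planeCone` (kernel, the other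
branch) re-assembled
> as `noTower_principalThreefold_of_port` (announced adaptation (α′): the wild column
`noTowerWild_principalThreefold_of_port` of
> `TauChainCutCells` is its `p ∣ n` specialisation, and `p ∣ a` is NOT available for the companion weight at inseparable-residue
> points), applied to `towerRestrict (towerOfCompanion T m a H hI) … U₀ …` with `U₀ = {ord H ≤ a} ∋ x_m` OPEN (upper
> semicontinuity of the order on the excellent regular stage, tree `OrderSemicontinuity.isClosed_setOf_le_idealOrder_general` +
> `Scheme.isExcellent_of_locallyOfFiniteType Stacks07QW_field_holds`) so that `IsDatum a` holds GLOBALLY on the new root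
> (announced adaptation (β′): re-rooting at stage `m` with base `U₀.ι ≫ toRoot T m ≫ g`, `tower_isBase` + g34
`towerRestrict_isBase`
> BY NAME; `PrincipalRoot` transported through the open-immersion stalk isomorphism; boundary `[]` by construction).
>
> Then THE CUT OF THE LOCATED RESIDUAL CELL C₃♮ (g35 `WildOccultDivisorialThreefoldNonLineMixed…Terminate n`, «the occult
> divisorial threefold tower that follows no line») EXACTLY (excluded middle on the letter) into
>   C₃♮ ∧ (I∞)  — DECIDED: EMPTY modulo the port `h640`
(`wildOccultDivisorialThreefoldNonLineIsolatedCompanionMixed_holds_of_port`),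
>   C₃♮ ∧ ¬(I∞) — UNDECIDED · IDEA-NEEDED: THE RECURRENTLY NON-ISOLATED COMPANION («every principal companion chain,
re-rooted at any
>                  later stage, is NON-ISOLATED in its own weight-`a` locus at some later stage» — proved reading
>                  `recurrent_nonIsolation`; at the desk = the RULED-RECURRENT core (RR) «infinitely many ruled
births» or a followed
>                  singular curve germ (CF), no law on record), the new LOCATED RESIDUAL of the column by name
>                  `NoWildOccultRecurrentCompanionNonLineMixedTowers` = (C₃♮ ∧ ¬I∞) ∧ C₄ ∧ D₄,
> with the exact re-locations `…_iff_g36` of C₃♮, C₃, C, and of the g35 / g34 / g33 / g32 / g31 residuals,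
HYPOTHESIS `h640` carried
> explicitly where it is load-bearing (the decided cell) and hypothesis-free elsewhere.
>
> WHY (I∞) IS NOT LETTERS-EXCLUDED (row 199): the letters of C₃♮ (`MixedResidual`, `¬ LatentFactorTower`, `DivisorialTower`,
> `ThreefoldTower`, `¬ FollowsLineTower`, and the root letters at weight `n`) constrain the marked ideal `𝓘 = h·K`
and the marked
> points of `T`; (I∞) speaks of the weight-`a` support of the factor `h` ALONE, along the same points, from a later
stage — no letter
> of C₃♮ mentions it, and its kill is CJS 6.40 + the τ-law transported to the companion hypersurface, not a letter
(critic letter row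
> 201a: accepted).  LESSON 8 (cn30): no inhabitant is certified by this node (the binders are infinite towers); the
§0 desk survivors
> of desk/DESK-g36.md are ROOT-LETTERS CANDIDATES only.
>
> HONEST TAGS.  DECIDED-MOD-PORT(CJS 6.40): the cell C₃♮ ∧ (I∞) (port load-bearing on the PlaneCone branch only; the
non-PlaneCone
> branch is kernel).  UNDECIDED: C₃♮ ∧ ¬(I∞), C₄, D₄ (and B mod 31571 as before).  COSTUME: none — every `_iff_g36`
is `Iff.rfl`-free
> logic over the g35 cells plus the one new law.  The typed reading `recurrent_nonIsolation` of ¬(I∞) is a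
CONSEQUENCE proved from
> the letters (kernel), not a re-typing of the cell.
>
> NO CARRY: g35's «CurveCut» §111–§113 is IN THE TREE (`Theorems/CurveCutKernels` + `Theorems/CurveCutCells`,
writer-1 g13, landed
> 2026-08-31 ≈09:28Z) and is IMPORTED; of it this file uses only the cell binder of C₃♮, `FollowsLineTower` and the g35 cells /
> re-locations BY NAME.  Nothing of g32–g35 is restated.
> Landing form (two cone-free tree files, cut at the `══ FILE` markers): FILE A `Theorems/IsoCompanionCutKernels.lean`
> = §115–§116 (imports `RestrictCutCells` suffices — §115–§116 use no g35 name — plus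
`WeightedInvariantOrderSemicontinuousSmooth`,
> Literature `QuasiExcellentSchemes` / `ExcellentRingsFieldProofs` / `StalkIdealLemmas`), FILE B
`Theorems/IsoCompanionCutCells.lean` = §117
> (imports FILE A + `CurveCutCells`).  No Theses-cone file (the re-locations compose with the g35/g34 ones by `Iff.trans`).

## This file

§117 (g36 · NEW) THE CELLS OF THE CUT OF C₃♮ BY THE COMPANION LETTER, BY NAME (cn26, tagged as in g33–g35), AND THE
RE-LOCATIONS (`section CompanionCells`): the terminate-predicates and `NoWild…Towers` classes of C₃♮ⁱ (occult
divisorial ∧ threefold ∧ non-line ∧ (I∞); DECIDED — EMPTY MODULO THE PORT: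
`wildOccultDivisorialThreefoldNonLineIsolatedCompanionMixed_holds_of_port`,
`noWildOccultDivisorialThreefoldNonLineIsolatedCompanionMixedTowers_holds_of_port`) and C₃♮ʳ (∧ ¬(I∞); UNDECIDED ·
IDEA-NEEDED — the recurrently non-isolated companion, the ruled-recurrent core; letters
`recurrentCompanion_letters`, `wildOccultDivisorialThreefoldNonLineRecurrentCompanionMixed_of_nonLine`); the split
`wildOccultDivisorialThreefoldNonLineMixed_split` (C₃♮ = C₃♮ⁱ ∧ C₃♮ʳ, em on the letter); the re-locations MODULO THE
PORT `…_iff_g36_of_port` (C₃♮ ⟺ C₃♮ʳ, C₃ ⟺ C₃♮ʳ, C ⟺ C₃♮ʳ ∧ C₄, g35 / g34 / g33 / g32 / g31 residuals ⟺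
**`NoWildOccultRecurrentCompanionNonLineMixedTowers`** = (C₃♮ʳ ∧ C₄) ∧ D₄ by definition — THE LOCATED RESIDUAL of
the lens-4 NP column after g36, whose cone-free HOME is this file) and the HYPOTHESIS-FREE down-links
`noWildOccultRecurrentCompanionNonLineMixedTowers_of_g35 / _of_g34 / _of_g32 / _of_aside` (from the TREE aside
`NoWildContactFreeOffLocusTowers`), `noWildOccultNonLineMixedTowers_of_g36_of_port`.

[WRITER NOTE (decomp-res writer g13): file split only, at the node's own `══ FILE` markers (tree files ≤ 400 lines);
namespace, sections, section variables and every declaration exactly as in the lens (the node's HOME-only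
dupNamespace-linter line is dropped — the library sets it; `noncomputable section` and the namespace-level `open`
lines of the node are replayed in both files).]

(Sources: CossartJannsenSaito2020 Thm. 6.40, Def. 6.38–6.39, Ch. 8; CossartPiltant2008 Prop. 4.2, Prop. 4.4;
Kollar2007 3.58–3.60; Hironaka1964 Ch. III; Giraud1975; Hauser2010Kangaroo; HauserPerlega2019 §2; Matsumura1987
Thms. 14.3, 32.4; StacksProject 07QW / 07P7 / 0C23.)
-/

noncomputable section

open CategoryTheory AlgebraicGeometry IsLocalRing TopologicalSpace
open Literature.AlgebraicGeometry.Resolution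
open Summit.ResolutionOfSingularities.ResolutionOfSingularities.Theorems
open WeakOrderReduction ForcedTowerClasses DivergentTowerClasses MonomialTowerClasses
open HugDimensionClasses HugDimensionKernels SurfaceShadowClasses SurfaceShadowKernels
open NearPointCut (SingularClass)
open Scheme.IdealSheafData (vanishingIdeal)
open scoped BigOperators

namespace Summit.ResolutionOfSingularities.ResolutionOfSingularities.Theorems.HugValuationCut

section CompanionCells

variable {k : Type} [Field k]

/-! ## ══ FILE B `Theorems/IsoCompanionCutCells.lean` (§117; cone-free: imports FILE A + `CurveCutCells`) ══ -/

/-! ## §117 (g36 · NEW) THE CELLS OF THE CUT OF C₃♮ BY THE COMPANION LETTER, BY NAME, AND THE RE-LOCATIONS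

CELL C₃♮ (g35, «the occult divisorial threefold tower that follows no line») = C₃♮ⁱ ∧ C₃♮ʳ EXACTLY (excluded middle on
`IsolatedCompanionTower`): C₃♮ⁱ («… with an ISOLATED principal companion») DECIDED — EMPTY MODULO THE SURFACE PORT (§116);
C₃♮ʳ («… all of whose principal companions are RECURRENTLY NON-ISOLATED») UNDECIDED · IDEA-NEEDED — THE
RULED-RECURRENT CORE, the
located residual core after g36 (mechanism proved from the letters: `recurrent_nonIsolation`, `recurrentCompanion_letters`; no
law on record; candidate invariant: the corner-pair potential of g35 §114 / a Hironaka-type resolution polygon of the pair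
`(h, K)` across ruled births — NEXT-g37).  Re-locations: MODULO THE PORT `h640` (carried explicitly) C₃♮ ⟺ C₃♮ʳ, C₃ ⟺ C₃♮ʳ,
C ⟺ C₃♮ʳ ∧ C₄, and the g35 located residual ⟺ (C₃♮ʳ ∧ C₄) ∧ D₄ =: `NoWildOccultRecurrentCompanionNonLineMixedTowers` (THE
LOCATED RESIDUAL after g36); HYPOTHESIS-FREE: the down-links (g36 residual ⟸ g35 / g34 / g32 residuals, ⟸ the tree aside). -/

/-- **CELL C₃♮ⁱ (occult divisorial threefold, follows no line, ISOLATED principal companion)** — DECIDED: EMPTY MODULO THE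
SURFACE PORT (`…IsolatedCompanionMixed_holds_of_port`). -/
def WildOccultDivisorialThreefoldNonLineIsolatedCompanionMixedWallFreeFreshJumpShallowCompanionKangarooTowersTerminate
    (n : ℕ) : Prop :=
  NoTowerWild n fun T => (((((MixedResidual n T ∧ ¬ (LatentFactorTower T ∧ ThreefoldTower T)) ∧ ¬ LatentFactorTower T) ∧
    DivisorialTower T) ∧ ThreefoldTower T) ∧ ¬ FollowsLineTower T) ∧ IsolatedCompanionTower T

/-- **CELL C₃♮ʳ (occult divisorial threefold, follows no line, every principal companion RECURRENTLY NON-ISOLATED) · THE LOCATED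
RESIDUAL CORE after g36 — «THE RULED-RECURRENT OCCULT THREEFOLD TOWER»** — UNDECIDED · IDEA-NEEDED (no law on
record; no certified
inhabitant: the §0 desk families die, desk/DESK-g36.md). -/
def WildOccultDivisorialThreefoldNonLineRecurrentCompanionMixedWallFreeFreshJumpShallowCompanionKangarooTowersTerminate
    (n : ℕ) : Prop :=
  NoTowerWild n fun T => (((((MixedResidual n T ∧ ¬ (LatentFactorTower T ∧ ThreefoldTower T)) ∧ ¬ LatentFactorTower T) ∧
    DivisorialTower T) ∧ ThreefoldTower T) ∧ ¬ FollowsLineTower T) ∧ ¬ IsolatedCompanionTower T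

/-- **EXACT (pure logic): CELL C₃♮ = C₃♮ⁱ ∧ C₃♮ʳ.** [folklore] -/
theorem wildOccultDivisorialThreefoldNonLineMixed_split (n : ℕ) :
    WildOccultDivisorialThreefoldNonLineMixedWallFreeFreshJumpShallowCompanionKangarooTowersTerminate n ↔
      WildOccultDivisorialThreefoldNonLineIsolatedCompanionMixedWallFreeFreshJumpShallowCompanionKangarooTowersTerminate n ∧
        WildOccultDivisorialThreefoldNonLineRecurrentCompanionMixedWallFreeFreshJumpShallowCompanionKangarooTowersTerminate n :=
  noTowerWild_split _ IsolatedCompanionTower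

/-- **CELL C₃♮ⁱ IS EMPTY MODULO THE SURFACE PORT (every `n`).** [folklore] -/
theorem wildOccultDivisorialThreefoldNonLineIsolatedCompanionMixed_holds_of_port (h640 : SurfaceChainPort) (n : ℕ) :
    WildOccultDivisorialThreefoldNonLineIsolatedCompanionMixedWallFreeFreshJumpShallowCompanionKangarooTowersTerminate n :=
  noTowerWild_mono (fun _ h => ⟨h.1, h.1.1.2, h.2⟩) (noTowerWild_threefold_isolatedCompanion_of_port h640 n fun T =>
    ((((MixedResidual n T ∧ ¬ (LatentFactorTower T ∧ ThreefoldTower T)) ∧ ¬ LatentFactorTower T) ∧ DivisorialTower T) ∧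
      ThreefoldTower T) ∧ ¬ FollowsLineTower T)

/-- **EXACT RE-LOCATION OF CELL C₃♮ MODULO THE PORT: C₃♮ ⟺ C₃♮ʳ.** [folklore] -/
theorem wildOccultDivisorialThreefoldNonLineMixed_iff_g36_of_port (h640 : SurfaceChainPort) (n : ℕ) :
    WildOccultDivisorialThreefoldNonLineMixedWallFreeFreshJumpShallowCompanionKangarooTowersTerminate n ↔
      WildOccultDivisorialThreefoldNonLineRecurrentCompanionMixedWallFreeFreshJumpShallowCompanionKangarooTowersTerminate n :=
  (wildOccultDivisorialThreefoldNonLineMixed_split n).trans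
    ⟨fun h => h.2, fun h => ⟨wildOccultDivisorialThreefoldNonLineIsolatedCompanionMixed_holds_of_port h640 n, h⟩⟩

/-- down-link, HYPOTHESIS-FREE: C₃♮ ⟹ C₃♮ʳ. [folklore] -/
theorem wildOccultDivisorialThreefoldNonLineRecurrentCompanionMixed_of_nonLine {n : ℕ}
    (h : WildOccultDivisorialThreefoldNonLineMixedWallFreeFreshJumpShallowCompanionKangarooTowersTerminate n) :
    WildOccultDivisorialThreefoldNonLineRecurrentCompanionMixedWallFreeFreshJumpShallowCompanionKangarooTowersTerminate n :=
  ((wildOccultDivisorialThreefoldNonLineMixed_split n).mp h).2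

/-- **EXACT RE-LOCATION OF CELL C₃ MODULO THE PORT: C₃ ⟺ C₃♮ʳ.** [folklore] -/
theorem wildOccultDivisorialThreefoldMixed_iff_g36_of_port (h640 : SurfaceChainPort) (n : ℕ) :
    WildOccultDivisorialThreefoldMixedWallFreeFreshJumpShallowCompanionKangarooTowersTerminate n ↔
      WildOccultDivisorialThreefoldNonLineRecurrentCompanionMixedWallFreeFreshJumpShallowCompanionKangarooTowersTerminate n :=
  (wildOccultDivisorialThreefoldMixed_iff_g35 n).trans (wildOccultDivisorialThreefoldNonLineMixed_iff_g36_of_port h640 n)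

/-- **EXACT RE-LOCATION OF CELL C MODULO THE PORT: C ⟺ C₃♮ʳ ∧ C₄.** [folklore] -/
theorem wildOccultDivisorialMixed_iff_g36_of_port (h640 : SurfaceChainPort) (n : ℕ) :
    WildOccultDivisorialMixedWallFreeFreshJumpShallowCompanionKangarooTowersTerminate n ↔
      WildOccultDivisorialThreefoldNonLineRecurrentCompanionMixedWallFreeFreshJumpShallowCompanionKangarooTowersTerminate n ∧
        WildOccultDivisorialNonThreefoldMixedWallFreeFreshJumpShallowCompanionKangarooTowersTerminate n :=
  (wildOccultDivisorialMixed_iff_g35 n).trans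
    (Iff.and (wildOccultDivisorialThreefoldNonLineMixed_iff_g36_of_port h640 n) Iff.rfl)

/-- **THE LETTERS OF THE LOCATED RESIDUAL CORE C₃♮ʳ, BY MECHANISM (kernel, from the letters)**: a tower of the cell
HAS principal
factors of weight `≥ 2` (`occult_letters`), and EVERY such factor, re-rooted at ANY later stage, is NON-ISOLATED in its own
weight locus at some later stage (`recurrent_nonIsolation`). [folklore] -/
theorem recurrentCompanion_letters (T : ForcedTower) (g : T.St 0 ⟶ Spec (.of k)) (hB : IsBase (T.St 0) g) {n : ℕ}
    (hD : IsDatum n (T.D 0))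
    (h : ((((((MixedResidual n T ∧ ¬ (LatentFactorTower T ∧ ThreefoldTower T)) ∧ ¬ LatentFactorTower T) ∧
      DivisorialTower T) ∧ ThreefoldTower T) ∧ ¬ FollowsLineTower T) ∧ ¬ IsolatedCompanionTower T)) :
    (∃ (m a b : ℕ) (H K : (T.St m).IdealSheafData), FactorAt T m a b H K ∧ 2 ≤ a ∧ (stalkIdeal H (T.pt m)).IsPrincipal) ∧
      ∀ (m a b : ℕ) (H K : (T.St m).IdealSheafData), FactorAt T m a b H K → 2 ≤ a → (stalkIdeal H (T.pt m)).IsPrincipal →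
        ∀ j₀, ∃ j, ¬ IsIsolatedIn (companionMarked T (m + j₀) a (facIter T m a H j₀) j).support (T.pt (m + j₀ + j)) :=
  ⟨(occult_letters h.1.1.1.1.2).2.2.2 h.1.1.1.2,
    fun _ _ _ _ _ hF ha hP j₀ => recurrent_nonIsolation T g hB hD h.2 hF ha hP j₀⟩

/-- BY NAME: **no wild occult divisorial threefold tower following no line WITH AN ISOLATED PRINCIPAL COMPANION** (CELL C₃♮ⁱ;
DECIDED-MOD-PORT). -/
def NoWildOccultDivisorialThreefoldNonLineIsolatedCompanionMixedTowers : Prop :=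
  ∀ n : ℕ, 1 ≤ n →
    WildOccultDivisorialThreefoldNonLineIsolatedCompanionMixedWallFreeFreshJumpShallowCompanionKangarooTowersTerminate n

/-- BY NAME: **no wild RULED-RECURRENT occult divisorial threefold tower** (CELL C₃♮ʳ; UNDECIDED — the located
residual core after
g36). -/
def NoWildOccultDivisorialThreefoldNonLineRecurrentCompanionMixedTowers : Prop :=
  ∀ n : ℕ, 1 ≤ n →
    WildOccultDivisorialThreefoldNonLineRecurrentCompanionMixedWallFreeFreshJumpShallowCompanionKangarooTowersTerminate n

/-- BY NAME: **THE LOCATED RESIDUAL of the lens-4 NP column after g36 — «no wild occult mixed tower that (is a ruled-recurrent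
divisorial threefold following no line) or is not a threefold»** = (C₃♮ʳ ∧ C₄) ∧ D₄. -/
def NoWildOccultRecurrentCompanionNonLineMixedTowers : Prop :=
  (NoWildOccultDivisorialThreefoldNonLineRecurrentCompanionMixedTowers ∧ NoWildOccultDivisorialNonThreefoldMixedTowers) ∧
    NoWildOccultNonDivisorialNonThreefoldMixedTowers

/-- **CELL C₃♮ⁱ DECIDED BY NAME, MODULO THE SURFACE PORT.** [folklore] -/
theorem noWildOccultDivisorialThreefoldNonLineIsolatedCompanionMixedTowers_holds_of_port (h640 : SurfaceChainPort) :
    NoWildOccultDivisorialThreefoldNonLineIsolatedCompanionMixedTowers := fun n _ =>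
  wildOccultDivisorialThreefoldNonLineIsolatedCompanionMixed_holds_of_port h640 n

/-- **EXACT RE-LOCATION BY NAME, MODULO THE PORT: CELL C₃♮ ⟺ CELL C₃♮ʳ.** [folklore] -/
theorem noWildOccultDivisorialThreefoldNonLineMixedTowers_iff_g36_of_port (h640 : SurfaceChainPort) :
    NoWildOccultDivisorialThreefoldNonLineMixedTowers ↔ NoWildOccultDivisorialThreefoldNonLineRecurrentCompanionMixedTowers :=
  ⟨fun h n hn => (wildOccultDivisorialThreefoldNonLineMixed_iff_g36_of_port h640 n).mp (h n hn),
    fun h n hn => (wildOccultDivisorialThreefoldNonLineMixed_iff_g36_of_port h640 n).mpr (h n hn)⟩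

/-- **EXACT RE-LOCATION BY NAME, MODULO THE PORT: CELL C₃ ⟺ CELL C₃♮ʳ.** [folklore] -/
theorem noWildOccultDivisorialThreefoldMixedTowers_iff_g36_of_port (h640 : SurfaceChainPort) :
    NoWildOccultDivisorialThreefoldMixedTowers ↔ NoWildOccultDivisorialThreefoldNonLineRecurrentCompanionMixedTowers :=
  noWildOccultDivisorialThreefoldMixedTowers_iff_g35.trans (noWildOccultDivisorialThreefoldNonLineMixedTowers_iff_g36_of_port h640)

/-- **EXACT RE-LOCATION BY NAME, MODULO THE PORT: the g35 located residual ⟺ the g36 located residual.** [folklore] -/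
theorem noWildOccultNonLineMixedTowers_iff_g36_of_port (h640 : SurfaceChainPort) :
    NoWildOccultNonLineMixedTowers ↔ NoWildOccultRecurrentCompanionNonLineMixedTowers :=
  Iff.and (Iff.and (noWildOccultDivisorialThreefoldNonLineMixedTowers_iff_g36_of_port h640) Iff.rfl) Iff.rfl

/-- **EXACT RE-LOCATION BY NAME, MODULO THE PORT: the g34 located residual (= C ∧ D₄) ⟺ the g36 located residual.**
[folklore] -/
theorem noWildOccultDivisorialOrNonThreefoldMixedTowers_iff_g36_of_port (h640 : SurfaceChainPort) :
    NoWildOccultDivisorialOrNonThreefoldMixedTowers ↔ NoWildOccultRecurrentCompanionNonLineMixedTowers :=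
  noWildOccultDivisorialOrNonThreefoldMixedTowers_iff_g35.trans (noWildOccultNonLineMixedTowers_iff_g36_of_port h640)

/-- **EXACT RE-LOCATION BY NAME, MODULO THE PORT: the g33 occult residual (= C ∧ D) ⟺ the g36 located residual.** [folklore] -/
theorem noWildOccultMixedTowers_iff_g36_of_port (h640 : SurfaceChainPort) :
    NoWildOccultMixedTowers ↔ NoWildOccultRecurrentCompanionNonLineMixedTowers :=
  noWildOccultMixedTowers_iff_g35.trans (noWildOccultNonLineMixedTowers_iff_g36_of_port h640)

/-- **EXACT RE-LOCATION BY NAME, MODULO THE PORT: the g32 residual ⟺ CELL B ∧ the g36 located residual.** [folklore] -/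
theorem noWildMixedWallFreeFreshJumpShallowCompanionKangarooTowers_iff_g36_of_port (h640 : SurfaceChainPort) :
    NoWildMixedWallFreeFreshJumpShallowCompanionKangarooTowers ↔
      NoWildLatentFactorNonThreefoldMixedTowers ∧ NoWildOccultRecurrentCompanionNonLineMixedTowers :=
  noWildMixedWallFreeFreshJumpShallowCompanionKangarooTowers_iff_g35.trans
    (Iff.and Iff.rfl (noWildOccultNonLineMixedTowers_iff_g36_of_port h640))

/-- **EXACT RE-LOCATION BY NAME, MODULO THE PORT: the g31 residual ⟺ CELL B ∧ the g36 located residual.** [folklore] -/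
theorem noWildNonSurfaceWallFreeFreshJumpShallowCompanionKangarooTowers_iff_g36_of_port (h640 : SurfaceChainPort) :
    NoWildNonSurfaceWallFreeFreshJumpShallowCompanionKangarooTowers ↔
      NoWildLatentFactorNonThreefoldMixedTowers ∧ NoWildOccultRecurrentCompanionNonLineMixedTowers :=
  noWildNonSurfaceWallFreeFreshJumpShallowCompanionKangarooTowers_iff_g35.trans
    (Iff.and Iff.rfl (noWildOccultNonLineMixedTowers_iff_g36_of_port h640))

/-- down-link (HYPOTHESIS-FREE): the g36 located residual ⟸ the g35 located residual. [folklore] -/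
theorem noWildOccultRecurrentCompanionNonLineMixedTowers_of_g35 (h : NoWildOccultNonLineMixedTowers) :
    NoWildOccultRecurrentCompanionNonLineMixedTowers :=
  ⟨⟨fun n hn => wildOccultDivisorialThreefoldNonLineRecurrentCompanionMixed_of_nonLine (h.1.1 n hn), h.1.2⟩, h.2⟩

/-- down-link (HYPOTHESIS-FREE): the g36 located residual ⟸ the g34 located residual. [folklore] -/
theorem noWildOccultRecurrentCompanionNonLineMixedTowers_of_g34 (h : NoWildOccultDivisorialOrNonThreefoldMixedTowers) :
    NoWildOccultRecurrentCompanionNonLineMixedTowers :=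
  noWildOccultRecurrentCompanionNonLineMixedTowers_of_g35 (noWildOccultNonLineMixedTowers_of_g34 h)

/-- down-link (HYPOTHESIS-FREE): the g36 located residual ⟸ the g32 residual. [folklore] -/
theorem noWildOccultRecurrentCompanionNonLineMixedTowers_of_g32 (h : NoWildMixedWallFreeFreshJumpShallowCompanionKangarooTowers) :
    NoWildOccultRecurrentCompanionNonLineMixedTowers :=
  noWildOccultRecurrentCompanionNonLineMixedTowers_of_g35 (noWildOccultNonLineMixedTowers_of_g32 h)

/-- down-link from the TREE aside `NoWildContactFreeOffLocusTowers` (HYPOTHESIS-FREE). [folklore] -/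
theorem noWildOccultRecurrentCompanionNonLineMixedTowers_of_aside (h : NoWildContactFreeOffLocusTowers) :
    NoWildOccultRecurrentCompanionNonLineMixedTowers :=
  noWildOccultRecurrentCompanionNonLineMixedTowers_of_g35 (noWildOccultNonLineMixedTowers_of_aside h)

/-- up-link MODULO THE PORT: the g35 located residual ⟸ the g36 located residual. [folklore] -/
theorem noWildOccultNonLineMixedTowers_of_g36_of_port (h640 : SurfaceChainPort)
    (h : NoWildOccultRecurrentCompanionNonLineMixedTowers) : NoWildOccultNonLineMixedTowers :=
  (noWildOccultNonLineMixedTowers_iff_g36_of_port h640).mpr h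

end CompanionCells

end Summit.ResolutionOfSingularities.ResolutionOfSingularities.Theorems.HugValuationCut
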